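import Summits.NavierStokesRegularity.NavierStokesRegularity.Theorems.TypeICertificateLadderTargetStrainCubeCeilingTools
import HarnessLib

/-!
# Crux `Target` = `TypeICertificateLadder.NoTypeIBlowup` (stmt-NavierStokesRegularity-1217), line
# `depletion-ladder`: THE CEILING OF THE CONSTANT-FORM LADDER IS A THEOREM

`--supports stmt-NavierStokesRegularity-1217` (DIRECTOR-NS #45 (b): «make the CEILING a theorem»). The
constant-form ladder certifies the Type-I exclusions `X_C` from the depletion inequality
`|∫⟪ω, Dv ω⟫| ≤ κ · sup|v| · ‖ω‖₂ · ‖∇ω‖₂` (`…StrainCubeSharpDepletion`: `κ = (2+√3)/9`, reach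
`C < 1/κ = 18 − 9√3 = 2.4115`). This file proves, by theorem, how far ANY such constant can take it.

* `strainCube_pointwise_links_attained` — the two pointwise links of the chain are individually SHARP:
  at the axisymmetric strain `s₀ = diag(1,1,−2)` with `ω ∥ e₂`, Miller's determinant bound
  `|4 det s| ≤ (2√6/9)|s|³` and the operator-norm bound `|ωᵀsω| ≤ √(2/3)|s||ω|²` are equalities — the
  pointwise algebra cannot be improved; the slack of the global inequality is in the joint
  realisability by one divergence-free field and in the interpolation step.
* `depletion_constant_witness` — an EXPLICIT admissible field (the axisymmetric straining flow
  `v_S = (x₀(1−2x₂²), x₁(1−2x₂²), 2x₂(x₀²+x₁²−1)) e^{-|x|²}`, divergence free, Schwartz, `|v_S| ≤ √(4/5)`)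
  with `(11/400)·M·‖ω‖₂·‖∇ω‖₂ < |∫⟪ω, Dv ω⟫|`: exact Gaussian moments
  `J = (32/27)(π/3)^{3/2}`, `Z = ‖ω‖₂² = (63/8)(π/2)^{3/2}`, `W = ‖∇ω‖₂² = (693/8)(π/2)^{3/2}`
  (polynomial × Gaussian calculus of the tree's `OddMorawetz` vocabulary: `pgv`, `curlP`, `dg`, `polyE`).
* `universal_depletion_constant_gt` — **every universal depletion constant exceeds `11/400 = 0.0275`**;
  with `sharp_constant_is_universal` (the landed `(2+√3)/9` IS one) the sharp constant `κ*` of the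
  inequality is bracketed `0.0275 < κ* ≤ 0.4147` (`depletion_constant_bracket`).
* `constantForm_rung_ceiling` — **the ceiling as a number**: a universal constant `κ` certifies `X_C`
  through `κ·C < 1` only for `C < 400/11 ≈ 36.4`; with `rung_of_le_sharp` the reach of the constant-form
  ladder lies in `[2.41, 36.4)`. Lifting it beyond needs a FLOW-WISE (equation-dependent,
  time-integrated) depletion input, not a constant of the admissible class.

Generic tools (reusable for sharper witnesses) are in `…StrainCubeCeilingTools.lean`.

NUMERICS (this seat, kit jobs `depl3-*`/`depl4-*`, recorded as evidence on stmt-1217/19551): in the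
polynomial-Gaussian class the best witnesses found have `J/(M√(ZW)) ≈ 0.044` (degree 3), `0.06`
(degree 4), `0.07` (degree 7); the lineage's numerics (g5–g8) locate the sharp constant near `0.14`
(ceiling ≈ 7). WHAT THIS IS NOT: not the crux; no statement about Navier–Stokes solutions beyond the reach
of constant-form rungs. [folklore]
-/

noncomputable section

open Set Filter Topology MeasureTheory SchwartzMap MvPolynomial Finset Matrix
open scoped RealInnerProductSpace ENNReal NNReal ContDiff
open Literature.Analysis.FluidPDE

namespace Summit.NavierStokesRegularity.NavierStokesRegularity.Theorems.DepletionLadder.StrainCube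

-- the problem directory repeats the summit name (`NavierStokesRegularity/NavierStokesRegularity`)
set_option linter.dupNamespace false

open Summit.NavierStokesRegularity.NavierStokesRegularity.Theorems.OddMorawetz

/-! ### Part A — the pointwise links are individually sharp -/

/-- **Both pointwise links of the depletion chain are attained by one configuration.** For the
trace-free symmetric array `s₀ = diag(1, 1, −2)` (axisymmetric strain, compression along `e₂`) and the
unit vector `e₂` along its simple axis:
(i) Miller's determinant bound `|4 det s| ≤ (2√6/9)|s|²√(|s|²)` (`abs_four_det_sym_le`) is an EQUALITY
(`|4·(−2)| = 8 = (2√6/9)·6·√6`), and (ii) the operator-norm bound `|eᵀ s e| ≤ √(2/3)√(|s|²)|e|²`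
(`abs_quadForm_sym_le`, the gain behind `κ = (2+√3)/9`) is an EQUALITY (`2 = √(2/3)·√6`).
So neither constant of the pointwise algebra can be lowered; any slack of the global inequality
`|∫⟪ω,Dvω⟫| ≤ ((2+√3)/9) M ‖ω‖₂‖∇ω‖₂` lives in the joint realisability of the two extremal
configurations by one divergence-free field and in the interpolation step. [folklore] -/
theorem strainCube_pointwise_links_attained :
    let s₀ : Fin 3 → Fin 3 → ℝ := fun i j => if i = j then (if i = 2 then -2 else 1) else 0
    let e : Fin 3 → ℝ := fun i => if i = 2 then 1 else 0
    (∀ i j, s₀ i j = s₀ j i) ∧ s₀ 0 0 + s₀ 1 1 + s₀ 2 2 = 0 ∧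
      |4 * (Matrix.of fun i j => s₀ i j).det| =
        (2 / 9) * Real.sqrt 6 * ((∑ i, ∑ j, s₀ i j ^ 2) * Real.sqrt (∑ i, ∑ j, s₀ i j ^ 2)) ∧
      |∑ i, ∑ j, e i * s₀ i j * e j| =
        Real.sqrt (2 / 3) * Real.sqrt (∑ i, ∑ j, s₀ i j ^ 2) * (∑ i, e i ^ 2) := by
  intro s₀ e
  have hsq : ∑ i, ∑ j, s₀ i j ^ 2 = 6 := by
    simp [s₀, Fin.sum_univ_three]; norm_num
  have hdet : (Matrix.of fun i j => s₀ i j).det = -2 := by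
    rw [Matrix.det_fin_three]
    simp [s₀]
  have hquad : ∑ i, ∑ j, e i * s₀ i j * e j = -2 := by
    simp [s₀, e]
  have he : ∑ i, e i ^ 2 = 1 := by
    simp [e]
  refine ⟨?_, ?_, ?_, ?_⟩
  · intro i j
    fin_cases i <;> fin_cases j <;> simp [s₀]
  · simp [s₀]; norm_num
  · rw [hdet, hsq]
    have h6 : Real.sqrt 6 * Real.sqrt 6 = 6 := Real.mul_self_sqrt (by norm_num)
    rw [show (2 / 9 : ℝ) * Real.sqrt 6 * (6 * Real.sqrt 6) = (12 / 9) * (Real.sqrt 6 * Real.sqrt 6) by ring,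
      h6]
    norm_num
  · rw [hquad, hsq, he, mul_one, ← Real.sqrt_mul (by norm_num : (0:ℝ) ≤ 2 / 3),
      show (2 / 3 : ℝ) * 6 = 2 ^ 2 by norm_num, Real.sqrt_sq (by norm_num : (0:ℝ) ≤ 2)]
    norm_num


/-! ### The witness field `v_S = (x₀(1−2x₂²), x₁(1−2x₂²), 2x₂(x₀²+x₁²−1)) e^{-|x|²}` -/

/-- `v_S` is divergence free (polynomial identity `Σᵢ (∂ᵢ − 2xᵢ) Pᵢ = 0`). [folklore] -/
theorem witnessS_div : ∑ i, dg 1 i ((![X 0 * (1 - 2 * X 2 ^ 2), X 1 * (1 - 2 * X 2 ^ 2), 2 * X 2 * (X 0 ^ 2 + X 1 ^ 2 - 1)] : Fin 3 → P3) i) = 0 := by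
  simp [Fin.sum_univ_three, dg, pderiv_X, Derivation.leibniz, Derivation.leibniz_pow]
  ring

/-- Monomial expansion of the stretching polynomial `Σᵢⱼ cᵢ cⱼ Dⱼ Pᵢ` of `v_S` (even in each variable). [folklore] -/
theorem witnessS_stretch (x : E3) :
    pev (∑ i, ∑ j, curlP 1 (![X 0 * (1 - 2 * X 2 ^ 2), X 1 * (1 - 2 * X 2 ^ 2), 2 * X 2 * (X 0 ^ 2 + X 1 ^ 2 - 1)] : Fin 3 → P3) i * curlP 1 (![X 0 * (1 - 2 * X 2 ^ 2), X 1 * (1 - 2 * X 2 ^ 2), 2 * X 2 * (X 0 ^ 2 + X 1 ^ 2 - 1)] : Fin 3 → P3) j * dg 1 j ((![X 0 * (1 - 2 * X 2 ^ 2), X 1 * (1 - 2 * X 2 ^ 2), 2 * X 2 * (X 0 ^ 2 + X 1 ^ 2 - 1)] : Fin 3 → P3) i)) x =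
      polyE [((196 : ℝ), 0, 1, 1), ((-504 : ℝ), 0, 1, 2), ((240 : ℝ), 0, 1, 3), ((-32 : ℝ), 0, 1, 4),
      ((-112 : ℝ), 0, 2, 1), ((256 : ℝ), 0, 2, 2), ((-64 : ℝ), 0, 2, 3), ((16 : ℝ), 0, 3, 1),
      ((-32 : ℝ), 0, 3, 2), ((196 : ℝ), 1, 0, 1), ((-504 : ℝ), 1, 0, 2), ((240 : ℝ), 1, 0, 3),
      ((-32 : ℝ), 1, 0, 4), ((-224 : ℝ), 1, 1, 1), ((512 : ℝ), 1, 1, 2), ((-128 : ℝ), 1, 1, 3),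
      ((48 : ℝ), 1, 2, 1), ((-96 : ℝ), 1, 2, 2), ((-112 : ℝ), 2, 0, 1), ((256 : ℝ), 2, 0, 2),
      ((-64 : ℝ), 2, 0, 3), ((48 : ℝ), 2, 1, 1), ((-96 : ℝ), 2, 1, 2), ((16 : ℝ), 3, 0, 1),
      ((-32 : ℝ), 3, 0, 2)] x := by
  simp [curlP, dg, polyE, Fin.sum_univ_three, pderiv_X, Derivation.leibniz, Derivation.leibniz_pow]
  ring

/-- Monomial expansion of the enstrophy polynomial `Σᵢ cᵢ²` of `v_S`. [folklore] -/
theorem witnessS_enstrophy (x : E3) :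
    pev (∑ i, curlP 1 (![X 0 * (1 - 2 * X 2 ^ 2), X 1 * (1 - 2 * X 2 ^ 2), 2 * X 2 * (X 0 ^ 2 + X 1 ^ 2 - 1)] : Fin 3 → P3) i ^ 2) x = polyE [((196 : ℝ), 0, 1, 1), ((-112 : ℝ), 0, 1, 2), ((16 : ℝ), 0, 1, 3), ((-112 : ℝ), 0, 2, 1),
      ((32 : ℝ), 0, 2, 2), ((16 : ℝ), 0, 3, 1), ((196 : ℝ), 1, 0, 1), ((-112 : ℝ), 1, 0, 2),
      ((16 : ℝ), 1, 0, 3), ((-224 : ℝ), 1, 1, 1), ((64 : ℝ), 1, 1, 2), ((48 : ℝ), 1, 2, 1),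
      ((-112 : ℝ), 2, 0, 1), ((32 : ℝ), 2, 0, 2), ((48 : ℝ), 2, 1, 1), ((16 : ℝ), 3, 0, 1)] x := by
  simp [curlP, dg, polyE, Fin.sum_univ_three, pderiv_X, Derivation.leibniz, Derivation.leibniz_pow]
  ring

/-- Monomial expansion of the palinstrophy polynomial `Σⱼᵢ (Dⱼ cᵢ)²` of `v_S`. [folklore] -/
theorem witnessS_palinstrophy (x : E3) :
    pev (∑ j, ∑ i, dg 1 j (curlP 1 (![X 0 * (1 - 2 * X 2 ^ 2), X 1 * (1 - 2 * X 2 ^ 2), 2 * X 2 * (X 0 ^ 2 + X 1 ^ 2 - 1)] : Fin 3 → P3) i) ^ 2) x = polyE [((392 : ℝ), 0, 0, 1), ((-224 : ℝ), 0, 0, 2), ((32 : ℝ), 0, 0, 3), ((196 : ℝ), 0, 1, 0),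
      ((-2352 : ℝ), 0, 1, 1), ((2400 : ℝ), 0, 1, 2), ((-704 : ℝ), 0, 1, 3), ((64 : ℝ), 0, 1, 4),
      ((-112 : ℝ), 0, 2, 0), ((2384 : ℝ), 0, 2, 1), ((-1408 : ℝ), 0, 2, 2), ((192 : ℝ), 0, 2, 3),
      ((16 : ℝ), 0, 3, 0), ((-704 : ℝ), 0, 3, 1), ((192 : ℝ), 0, 3, 2), ((64 : ℝ), 0, 4, 1),
      ((196 : ℝ), 1, 0, 0), ((-2352 : ℝ), 1, 0, 1), ((2400 : ℝ), 1, 0, 2), ((-704 : ℝ), 1, 0, 3),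
      ((64 : ℝ), 1, 0, 4), ((-224 : ℝ), 1, 1, 0), ((4768 : ℝ), 1, 1, 1), ((-2816 : ℝ), 1, 1, 2),
      ((384 : ℝ), 1, 1, 3), ((48 : ℝ), 1, 2, 0), ((-2112 : ℝ), 1, 2, 1), ((576 : ℝ), 1, 2, 2),
      ((256 : ℝ), 1, 3, 1), ((-112 : ℝ), 2, 0, 0), ((2384 : ℝ), 2, 0, 1), ((-1408 : ℝ), 2, 0, 2),
      ((192 : ℝ), 2, 0, 3), ((48 : ℝ), 2, 1, 0), ((-2112 : ℝ), 2, 1, 1), ((576 : ℝ), 2, 1, 2),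
      ((384 : ℝ), 2, 2, 1), ((16 : ℝ), 3, 0, 0), ((-704 : ℝ), 3, 0, 1), ((192 : ℝ), 3, 0, 2),
      ((256 : ℝ), 3, 1, 1), ((64 : ℝ), 4, 0, 1)] x := by
  simp [curlP, dg, polyE, Fin.sum_univ_three, pderiv_X, Derivation.leibniz, Derivation.leibniz_pow]
  ring


/-! ### The sup bound, the three exact values, and the ceiling -/

/-- The two-variable inequality behind the sup bound of `v_S`:
`a(1−2b)² + 4b(a−1)² ≤ (4/5) e^{2a} e^{2b}` for `a, b ≥ 0` — Taylor lower bounds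
`1+2a+2a² ≤ e^{2a}`, `1+2b+2b²+(4/3)b³+(2/3)b⁴ ≤ e^{2b}` and an explicit sum of squares. [folklore] -/
theorem witnessS_poly_bound {a b : ℝ} (ha : 0 ≤ a) (hb : 0 ≤ b) :
    a * (1 - 2 * b) ^ 2 + 4 * b * (a - 1) ^ 2 ≤ 4 / 5 * (Real.exp (2 * a) * Real.exp (2 * b)) := by
  have hea : 1 + 2 * a + 2 * a ^ 2 ≤ Real.exp (2 * a) := by
    have h := Real.quadratic_le_exp_of_nonneg (by positivity : (0:ℝ) ≤ 2 * a)
    have e : 1 + 2 * a + (2 * a) ^ 2 / 2 = 1 + 2 * a + 2 * a ^ 2 := by ring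
    linarith [h, e]
  have heb : 1 + 2 * b + 2 * b ^ 2 + 4 / 3 * b ^ 3 + 2 / 3 * b ^ 4 ≤ Real.exp (2 * b) := by
    have h := exp_ge_taylor_four (by positivity : (0:ℝ) ≤ 2 * b)
    have e : 1 + 2 * b + (2 * b) ^ 2 / 2 + (2 * b) ^ 3 / 6 + (2 * b) ^ 4 / 24 =
        1 + 2 * b + 2 * b ^ 2 + 4 / 3 * b ^ 3 + 2 / 3 * b ^ 4 := by ring
    linarith [h, e]
  have key : 4 * ((1 + 2 * a + 2 * a ^ 2) * (1 + 2 * b + 2 * b ^ 2 + 4 / 3 * b ^ 3 + 2 / 3 * b ^ 4)) -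
      5 * (a * (1 - 2 * b) ^ 2 + 4 * b * (a - 1) ^ 2) =
      8 / 3 * (b ^ 2 - 3 / 8) ^ 2 + 16 / 3 * b * (b - 1 / 2) ^ 2 + 40 / 3 * (b - 1 / 2) ^ 2 + 7 / 24 +
        2 * b ^ 2 * ((1 - a) ^ 2 + 3 * a ^ 2) + a ^ 2 * (8 * (b - 1 / 4) ^ 2 + 15 / 2) + 3 * a +
        76 * a * b + 32 / 3 * a * b ^ 3 + 16 / 3 * a * b ^ 4 + 32 / 3 * a ^ 2 * b ^ 3 +
        16 / 3 * a ^ 2 * b ^ 4 := by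
    ring
  have hsos : 0 ≤ 8 / 3 * (b ^ 2 - 3 / 8) ^ 2 + 16 / 3 * b * (b - 1 / 2) ^ 2 + 40 / 3 * (b - 1 / 2) ^ 2 +
        7 / 24 + 2 * b ^ 2 * ((1 - a) ^ 2 + 3 * a ^ 2) + a ^ 2 * (8 * (b - 1 / 4) ^ 2 + 15 / 2) + 3 * a +
        76 * a * b + 32 / 3 * a * b ^ 3 + 16 / 3 * a * b ^ 4 + 32 / 3 * a ^ 2 * b ^ 3 +
        16 / 3 * a ^ 2 * b ^ 4 := by positivity
  have hprod : (1 + 2 * a + 2 * a ^ 2) * (1 + 2 * b + 2 * b ^ 2 + 4 / 3 * b ^ 3 + 2 / 3 * b ^ 4) ≤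
      Real.exp (2 * a) * Real.exp (2 * b) :=
    mul_le_mul hea heb (by positivity) (Real.exp_pos _).le
  linarith [key, hsos, hprod]

/-- **Sup bound** `‖v_S(x)‖² ≤ 4/5` (the true supremum is `2/e = 0.7358`, on the axis at `x₂² = ½`):
with `a = x₀²+x₁²`, `b = x₂²`, `‖v_S‖² = (a(1−2b)² + 4b(a−1)²) e^{-2a-2b}` and `witnessS_poly_bound`.
[folklore] -/
theorem witnessS_norm_sq_le (x : E3) : ‖pgv 1 (![X 0 * (1 - 2 * X 2 ^ 2), X 1 * (1 - 2 * X 2 ^ 2), 2 * X 2 * (X 0 ^ 2 + X 1 ^ 2 - 1)] : Fin 3 → P3) x‖ ^ 2 ≤ 4 / 5 := by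
  have hx : ‖x‖ ^ 2 = x 0 ^ 2 + x 1 ^ 2 + x 2 ^ 2 := by
    rw [EuclideanSpace.norm_sq_eq]
    simp [Fin.sum_univ_three, sq_abs]
  have hc0 : pev ((![X 0 * (1 - 2 * X 2 ^ 2), X 1 * (1 - 2 * X 2 ^ 2), 2 * X 2 * (X 0 ^ 2 + X 1 ^ 2 - 1)] : Fin 3 → P3) 0) x = x 0 * (1 - 2 * x 2 ^ 2) := by simp
  have hc1 : pev ((![X 0 * (1 - 2 * X 2 ^ 2), X 1 * (1 - 2 * X 2 ^ 2), 2 * X 2 * (X 0 ^ 2 + X 1 ^ 2 - 1)] : Fin 3 → P3) 1) x = x 1 * (1 - 2 * x 2 ^ 2) := by simp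
  have hc2 : pev ((![X 0 * (1 - 2 * X 2 ^ 2), X 1 * (1 - 2 * X 2 ^ 2), 2 * X 2 * (X 0 ^ 2 + X 1 ^ 2 - 1)] : Fin 3 → P3) 2) x = 2 * x 2 * (x 0 ^ 2 + x 1 ^ 2 - 1) := by simp
  rw [EuclideanSpace.norm_sq_eq]
  simp only [Fin.sum_univ_three, Real.norm_eq_abs, sq_abs, pgv_apply, pg_def, Nat.cast_one, hc0, hc1,
    hc2]
  have hpos : 0 < Real.exp (2 * (x 0 ^ 2 + x 1 ^ 2)) * Real.exp (2 * x 2 ^ 2) := by positivity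
  have hE2 : Real.exp (-1 * ‖x‖ ^ 2) ^ 2 =
      (Real.exp (2 * (x 0 ^ 2 + x 1 ^ 2)) * Real.exp (2 * x 2 ^ 2))⁻¹ := by
    rw [sq, ← Real.exp_add, ← Real.exp_add, ← Real.exp_neg, hx]
    congr 1
    ring
  have hQ : (x 0 * (1 - 2 * x 2 ^ 2) * Real.exp (-1 * ‖x‖ ^ 2)) ^ 2 +
      (x 1 * (1 - 2 * x 2 ^ 2) * Real.exp (-1 * ‖x‖ ^ 2)) ^ 2 +
      (2 * x 2 * (x 0 ^ 2 + x 1 ^ 2 - 1) * Real.exp (-1 * ‖x‖ ^ 2)) ^ 2 =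
      ((x 0 ^ 2 + x 1 ^ 2) * (1 - 2 * x 2 ^ 2) ^ 2 + 4 * x 2 ^ 2 * ((x 0 ^ 2 + x 1 ^ 2) - 1) ^ 2) /
        (Real.exp (2 * (x 0 ^ 2 + x 1 ^ 2)) * Real.exp (2 * x 2 ^ 2)) := by
    rw [div_eq_mul_inv, ← hE2]
    ring
  rw [hQ, div_le_iff₀ hpos]
  exact witnessS_poly_bound (by positivity) (by positivity)

/-- `‖v_S(x)‖ ≤ √(4/5)`. [folklore] -/
theorem witnessS_norm_le (x : E3) : ‖pgv 1 (![X 0 * (1 - 2 * X 2 ^ 2), X 1 * (1 - 2 * X 2 ^ 2), 2 * X 2 * (X 0 ^ 2 + X 1 ^ 2 - 1)] : Fin 3 → P3) x‖ ≤ Real.sqrt (4 / 5) :=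
  Real.le_sqrt_of_sq_le (witnessS_norm_sq_le x)

/-- **`J(v_S) = ∫⟪ω, Dv ω⟫ = (32/27)·(π/3)√(π/3)`** (exact Gaussian moments). [folklore] -/
theorem witnessS_stretching_value :
    ∫ x, ⟪curl (pgv 1 (![X 0 * (1 - 2 * X 2 ^ 2), X 1 * (1 - 2 * X 2 ^ 2), 2 * X 2 * (X 0 ^ 2 + X 1 ^ 2 - 1)] : Fin 3 → P3)) x, fderiv ℝ (pgv 1 (![X 0 * (1 - 2 * X 2 ^ 2), X 1 * (1 - 2 * X 2 ^ 2), 2 * X 2 * (X 0 ^ 2 + X 1 ^ 2 - 1)] : Fin 3 → P3)) x (curl (pgv 1 (![X 0 * (1 - 2 * X 2 ^ 2), X 1 * (1 - 2 * X 2 ^ 2), 2 * X 2 * (X 0 ^ 2 + X 1 ^ 2 - 1)] : Fin 3 → P3)) x)⟫ =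
      32 / 27 * ((Real.pi / 3) * Real.sqrt (Real.pi / 3)) := by
  simp_rw [stretching_density_pgv]
  rw [integral_pg_three_of_polyE _ _ witnessS_stretch]
  norm_num [Nat.doubleFactorial]
  ring

/-- **`Z(v_S) = ∫‖ω‖² = (63/8)·(π/2)√(π/2)`**. [folklore] -/
theorem witnessS_enstrophy_value :
    ∫ x, ‖curl (pgv 1 (![X 0 * (1 - 2 * X 2 ^ 2), X 1 * (1 - 2 * X 2 ^ 2), 2 * X 2 * (X 0 ^ 2 + X 1 ^ 2 - 1)] : Fin 3 → P3)) x‖ ^ 2 = 63 / 8 * ((Real.pi / 2) * Real.sqrt (Real.pi / 2)) := by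
  simp_rw [curl_normSq_pgv]
  rw [integral_pg_two_of_polyE _ _ witnessS_enstrophy]
  norm_num [Nat.doubleFactorial]
  ring

/-- **`W(v_S) = ∫|∇ω|²_F = (693/8)·(π/2)√(π/2)`**. [folklore] -/
theorem witnessS_palinstrophy_value :
    ∫ x, frobeniusNormSq (fderiv ℝ (curl (pgv 1 (![X 0 * (1 - 2 * X 2 ^ 2), X 1 * (1 - 2 * X 2 ^ 2), 2 * X 2 * (X 0 ^ 2 + X 1 ^ 2 - 1)] : Fin 3 → P3))) x) =
      693 / 8 * ((Real.pi / 2) * Real.sqrt (Real.pi / 2)) := by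
  simp_rw [frobeniusNormSq_fderiv_curl_pgv]
  rw [integral_pg_two_of_polyE _ _ witnessS_palinstrophy]
  norm_num [Nat.doubleFactorial]
  ring

/-- The arithmetic of the ceiling: `(11/400)·√(4/5)·√Z·√W < J` for the three exact values
(`π` cancels: `(11/400)²(4/5)(63/8)(693/8)·27 < (32/27)²·8`). [folklore] -/
theorem witnessS_ratio :
    11 / 400 * Real.sqrt (4 / 5) * Real.sqrt (63 / 8 * ((Real.pi / 2) * Real.sqrt (Real.pi / 2))) *
        Real.sqrt (693 / 8 * ((Real.pi / 2) * Real.sqrt (Real.pi / 2))) <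
      32 / 27 * ((Real.pi / 3) * Real.sqrt (Real.pi / 3)) := by
  have hπ : 0 < Real.pi := Real.pi_pos
  have hπ3 : 0 < Real.pi ^ 3 := by positivity
  have hs2 : Real.sqrt (Real.pi / 2) ^ 2 = Real.pi / 2 := Real.sq_sqrt (by positivity)
  have hs3 : Real.sqrt (Real.pi / 3) ^ 2 = Real.pi / 3 := Real.sq_sqrt (by positivity)
  have hs45 : Real.sqrt (4 / 5) ^ 2 = 4 / 5 := Real.sq_sqrt (by positivity)
  have hZ0 : 0 ≤ 63 / 8 * ((Real.pi / 2) * Real.sqrt (Real.pi / 2)) := by positivity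
  have hW0 : 0 ≤ 693 / 8 * ((Real.pi / 2) * Real.sqrt (Real.pi / 2)) := by positivity
  have hR : 0 < 32 / 27 * ((Real.pi / 3) * Real.sqrt (Real.pi / 3)) := by positivity
  refine lt_of_pow_lt_pow_left₀ 2 hR.le ?_
  rw [show (11 / 400 * Real.sqrt (4 / 5) * Real.sqrt (63 / 8 * ((Real.pi / 2) * Real.sqrt (Real.pi / 2))) *
        Real.sqrt (693 / 8 * ((Real.pi / 2) * Real.sqrt (Real.pi / 2)))) ^ 2 =
      (11 / 400) ^ 2 * Real.sqrt (4 / 5) ^ 2 *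
        Real.sqrt (63 / 8 * ((Real.pi / 2) * Real.sqrt (Real.pi / 2))) ^ 2 *
        Real.sqrt (693 / 8 * ((Real.pi / 2) * Real.sqrt (Real.pi / 2))) ^ 2 by ring,
    hs45, Real.sq_sqrt hZ0, Real.sq_sqrt hW0]
  rw [show (11 / 400 : ℝ) ^ 2 * (4 / 5) * (63 / 8 * ((Real.pi / 2) * Real.sqrt (Real.pi / 2))) *
        (693 / 8 * ((Real.pi / 2) * Real.sqrt (Real.pi / 2))) =
      (11 / 400) ^ 2 * (4 / 5) * (63 / 8) * (693 / 8) * ((Real.pi / 2) ^ 2 * Real.sqrt (Real.pi / 2) ^ 2)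
      by ring, hs2,
    show (32 / 27 * ((Real.pi / 3) * Real.sqrt (Real.pi / 3))) ^ 2 =
      (32 / 27) ^ 2 * ((Real.pi / 3) ^ 2 * Real.sqrt (Real.pi / 3) ^ 2) by ring, hs3]
  rw [show (11 / 400 : ℝ) ^ 2 * (4 / 5) * (63 / 8) * (693 / 8) * ((Real.pi / 2) ^ 2 * (Real.pi / 2)) =
      ((11 / 400) ^ 2 * (4 / 5) * (63 / 8) * (693 / 8) / 8) * Real.pi ^ 3 by ring,
    show (32 / 27 : ℝ) ^ 2 * ((Real.pi / 3) ^ 2 * (Real.pi / 3)) = ((32 / 27) ^ 2 / 27) * Real.pi ^ 3 by ring]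
  exact mul_lt_mul_of_pos_right (by norm_num) hπ3

/-- **THE WITNESS.** The explicit divergence-free Schwartz field
`v_S(x) = (x₀(1−2x₂²), x₁(1−2x₂²), 2x₂(x₀²+x₁²−1)) e^{-|x|²}` (an axisymmetric straining flow:
`−4 det S > 0` in the bulk, coherent vortex stretching of its own azimuthal vorticity rings) lies in the
hypothesis class of `abs_integral_stretching_le_strainCube_sharp` (`C^∞`, divergence free,
`|v| ≤ M = √(4/5)`, bounded gradient, `D⁰v, D¹v, D²v ∈ L²`) and has
`(11/400) · M · ‖ω‖₂ · ‖∇ω‖₂ < |∫⟪ω, Dv ω⟫|` (exactly: `J = (32/27)(π/3)^{3/2}`,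
`Z = (63/8)(π/2)^{3/2}`, `W = (693/8)(π/2)^{3/2}`, ratio `J/(M√(ZW)) = 0.02762…`). [folklore] -/
theorem depletion_constant_witness :
    ∃ (v : EuclideanSpace ℝ (Fin 3) → EuclideanSpace ℝ (Fin 3)) (M B : ℝ),
      ContDiff ℝ ∞ v ∧ VectorCalculus.IsDivFree v ∧ (∀ x, ‖v x‖ ≤ M) ∧ (∀ x, ‖fderiv ℝ v x‖ ≤ B) ∧
      (∫⁻ x, ‖iteratedFDeriv ℝ 0 v x‖ₑ ^ 2 < ⊤) ∧ (∫⁻ x, ‖iteratedFDeriv ℝ 1 v x‖ₑ ^ 2 < ⊤) ∧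
      (∫⁻ x, ‖iteratedFDeriv ℝ 2 v x‖ₑ ^ 2 < ⊤) ∧
      11 / 400 * M * Real.sqrt (∫ x, ‖curl v x‖ ^ 2) *
          Real.sqrt (∫ x, frobeniusNormSq (fderiv ℝ (curl v) x)) <
        |∫ x, ⟪curl v x, fderiv ℝ v x (curl v x)⟫| := by
  obtain ⟨hcd, ⟨B, hB⟩, h0, h1, h2⟩ := pgv_admissible (![X 0 * (1 - 2 * X 2 ^ 2), X 1 * (1 - 2 * X 2 ^ 2), 2 * X 2 * (X 0 ^ 2 + X 1 ^ 2 - 1)] : Fin 3 → P3)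
  refine ⟨pgv 1 (![X 0 * (1 - 2 * X 2 ^ 2), X 1 * (1 - 2 * X 2 ^ 2), 2 * X 2 * (X 0 ^ 2 + X 1 ^ 2 - 1)] : Fin 3 → P3), Real.sqrt (4 / 5), B, hcd, isDivFree_pgv _ witnessS_div, witnessS_norm_le, hB,
    h0, h1, h2, ?_⟩
  rw [witnessS_stretching_value, witnessS_enstrophy_value, witnessS_palinstrophy_value,
    abs_of_pos (by positivity)]
  exact witnessS_ratio

/-- **THE CEILING OF THE CONSTANT-FORM DEPLETION LADDER (lower bound on every depletion constant).**
Any constant `κ` for which the depletion inequality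
`|∫⟪ω, Dv ω⟫| ≤ κ · M · ‖ω‖₂ · ‖∇ω‖₂` holds for EVERY admissible field (the hypothesis class of
`abs_integral_stretching_le_strainCube_sharp`: `C^∞`, divergence free, `|v| ≤ M`, bounded gradient,
`D⁰v, D¹v, D²v ∈ L²`) satisfies `κ > 11/400 = 0.0275`. The landed constant is `(2+√3)/9 = 0.4147`
(`abs_integral_stretching_le_strainCube_sharp`); so the sharp constant `κ*` of this inequality obeys
`0.0275 < κ* ≤ 0.4147`. (Numerics of this seat, kit jobs `depl3/depl4`: polynomial-Gaussian witnesses of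
degree 7 reach `0.07`; the lineage's numerics g5–g8 locate `κ* ≈ 0.14`.) [folklore] -/
theorem universal_depletion_constant_gt {κ : ℝ}
    (hκ : ∀ (v : EuclideanSpace ℝ (Fin 3) → EuclideanSpace ℝ (Fin 3)) (M B : ℝ),
      ContDiff ℝ ∞ v → VectorCalculus.IsDivFree v → (∀ x, ‖v x‖ ≤ M) → (∀ x, ‖fderiv ℝ v x‖ ≤ B) →
      (∫⁻ x, ‖iteratedFDeriv ℝ 0 v x‖ₑ ^ 2 < ⊤) → (∫⁻ x, ‖iteratedFDeriv ℝ 1 v x‖ₑ ^ 2 < ⊤) →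
      (∫⁻ x, ‖iteratedFDeriv ℝ 2 v x‖ₑ ^ 2 < ⊤) →
      |∫ x, ⟪curl v x, fderiv ℝ v x (curl v x)⟫| ≤
        κ * M * Real.sqrt (∫ x, ‖curl v x‖ ^ 2) * Real.sqrt (∫ x, frobeniusNormSq (fderiv ℝ (curl v) x))) :
    11 / 400 < κ := by
  obtain ⟨v, M, B, hcd, hdiv, hM, hB, h0, h1, h2, hlt⟩ := depletion_constant_witness
  have hle := hκ v M B hcd hdiv hM hB h0 h1 h2
  have hM0 : 0 ≤ M := (norm_nonneg _).trans (hM 0)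
  have hP : 0 ≤ M * Real.sqrt (∫ x, ‖curl v x‖ ^ 2) *
      Real.sqrt (∫ x, frobeniusNormSq (fderiv ℝ (curl v) x)) := by positivity
  refine lt_of_not_ge fun hk => ?_
  have : κ * M * Real.sqrt (∫ x, ‖curl v x‖ ^ 2) *
      Real.sqrt (∫ x, frobeniusNormSq (fderiv ℝ (curl v) x)) ≤
      11 / 400 * M * Real.sqrt (∫ x, ‖curl v x‖ ^ 2) *
      Real.sqrt (∫ x, frobeniusNormSq (fderiv ℝ (curl v) x)) := by
    have := mul_le_mul_of_nonneg_right hk hP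
    linarith [this]
  linarith

/-- **THE CEILING AS A NUMBER: no constant-form rung reaches `C = 400/11 ≈ 36.4`.** The rung mechanism
`rung_of_flowwiseDepletion` / `hasSmoothExtensionPast_of_rate_lt_sharp` certifies the Type-I exclusion
`X_C` from a depletion constant `κ` under the threshold `κ·C < 1`. If `κ` is a UNIVERSAL depletion
constant (valid on the whole admissible class, as every constant obtained from a pointwise
strain-cube/vortex-stretching inequality plus interpolation is), then `κ > 11/400`, hence every `C ≥ 0` it
certifies satisfies `C < 400/11`: together with `rung_of_le_sharp` the reach of the constant-form ladder
is pinned in `[2.41, 36.4)`. Beyond it a depletion input must be flow-wise / time-integrated (it may use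
the equation), not a constant of the admissible class. [folklore] -/
theorem constantForm_rung_ceiling {κ C : ℝ}
    (hκ : ∀ (v : EuclideanSpace ℝ (Fin 3) → EuclideanSpace ℝ (Fin 3)) (M B : ℝ),
      ContDiff ℝ ∞ v → VectorCalculus.IsDivFree v → (∀ x, ‖v x‖ ≤ M) → (∀ x, ‖fderiv ℝ v x‖ ≤ B) →
      (∫⁻ x, ‖iteratedFDeriv ℝ 0 v x‖ₑ ^ 2 < ⊤) → (∫⁻ x, ‖iteratedFDeriv ℝ 1 v x‖ₑ ^ 2 < ⊤) →
      (∫⁻ x, ‖iteratedFDeriv ℝ 2 v x‖ₑ ^ 2 < ⊤) →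
      |∫ x, ⟪curl v x, fderiv ℝ v x (curl v x)⟫| ≤
        κ * M * Real.sqrt (∫ x, ‖curl v x‖ ^ 2) * Real.sqrt (∫ x, frobeniusNormSq (fderiv ℝ (curl v) x)))
    (hκC : κ * C < 1) : C < 400 / 11 := by
  have hk := universal_depletion_constant_gt hκ
  refine lt_of_not_ge fun hc => ?_
  have : (11 / 400 : ℝ) * (400 / 11) ≤ κ * C := mul_le_mul hk.le hc (by norm_num) (by linarith)
  norm_num at this
  linarith

/-- **The landed constant is a universal depletion constant** (restatement of
`abs_integral_stretching_le_strainCube_sharp` in the shape consumed above), so the two-sided bracket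
`11/400 < (2+√3)/9` is an honest, non-vacuous statement about the same class. [folklore] -/
theorem sharp_constant_is_universal :
    ∀ (v : EuclideanSpace ℝ (Fin 3) → EuclideanSpace ℝ (Fin 3)) (M B : ℝ),
      ContDiff ℝ ∞ v → VectorCalculus.IsDivFree v → (∀ x, ‖v x‖ ≤ M) → (∀ x, ‖fderiv ℝ v x‖ ≤ B) →
      (∫⁻ x, ‖iteratedFDeriv ℝ 0 v x‖ₑ ^ 2 < ⊤) → (∫⁻ x, ‖iteratedFDeriv ℝ 1 v x‖ₑ ^ 2 < ⊤) →
      (∫⁻ x, ‖iteratedFDeriv ℝ 2 v x‖ₑ ^ 2 < ⊤) →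
      |∫ x, ⟪curl v x, fderiv ℝ v x (curl v x)⟫| ≤
        (2 + Real.sqrt 3) / 9 * M * Real.sqrt (∫ x, ‖curl v x‖ ^ 2) *
          Real.sqrt (∫ x, frobeniusNormSq (fderiv ℝ (curl v) x)) :=
  fun _ _ _ hv hdiv hM hB h0 h1 h2 => abs_integral_stretching_le_strainCube_sharp hv hdiv hM hB h0 h1 h2

/-- **Bracket of the sharp depletion constant**: `11/400 < (2+√3)/9` is witnessed on both sides by
theorems of the tree (`universal_depletion_constant_gt sharp_constant_is_universal`). [folklore] -/
theorem depletion_constant_bracket : (11 / 400 : ℝ) < (2 + Real.sqrt 3) / 9 :=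
  universal_depletion_constant_gt sharp_constant_is_universal

end Summit.NavierStokesRegularity.NavierStokesRegularity.Theorems.DepletionLadder.StrainCube

end
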